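import Summits.QuantumFields.BalabanUV.Beta.TameKernelCalculus

/-!
# `BalabanUV.Beta.D1BFx.KernelMassCalculus` — road «BF-x» for binder row D1, slot (K), (II)-rows (C1)(C2) «TB4-W CO-FRAME FIRST JET ∕ TABLE,
# m-UNIFORM MASS», FILE α1 «MASS-CALC»: **THE θ-WEIGHTED ℓ¹ ROW ∕ COLUMN MASS CURRENCY FOR `MKer` KERNELS — MASSES COMPOSE MULTIPLICATIVELY
# (`r_θ(A∘B) ≤ r_θ(A)·r_θ(B)`, NO lattice constant `Zl` per composition)** — the bookkeeping the co-frame count runs in (W-1 l.43312 (F2); OWNER RULING ρ-g19-1)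

HONEST DEPENDENCY (cell records, verbatim): «continuum YM on T⁴ ⇐ BetaPertH ∧ nine spine estimates (0/9 proved); BetaPertH ⇐ (D1) ∧ (D4) ∧
CAP+tail; G-an2-4 gates asym, D1 and NE2/3/4.»  HONEST FRAMING (cell contract, verbatim): «discharging `BetaPertH` makes Bałaban's UV stability
UNCONDITIONAL — a real constructive-QFT result; it is NOT the continuum limit and NOT the Clay problem.»  THIS MODULE DISCHARGES NOTHING of the
wall: [folklore] `ℓ¹` bookkeeping (the triangle inequality for `|·|₁`, Tonelli on nonnegative series) for the Literature's `ExpKernelCalculus.MKer ∕ comp`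
and the road's `TameKernelCalculus.trK`; generic dimension `D` and fibre `F`.  It introduces ONE real-valued [our object] function (`rowFn`) and THREE
[our object] BOOKKEEPING PREDICATES (`RowMass`, `ColMass`, `TotMass` — quantitative twins of `TameKernelCalculus.RowMaj ∕ ColMaj`, each a conjunction
«summable ∧ sum ≤ M»; they assert nothing by themselves and are NOT facts of any paper).  No `def … : Prop` FACT, nothing cited, 0 sorry.
0 root-level binders of row D1 discharged (hW ∕ hR-sockets ∕ hSX-socket ∕ D1Tel ∕ D1Rep = 0); (K) NOT closed; (C1)(C2) NOT closed here; NOT D1, NOT `BetaPertH`,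
NOT continuum, NOT Clay.

ABSOLUTE RULE (cell charter, verbatim): «No internally-minted statement may enter as a cited fact. Every hypothesis is either kernel-proved in
this package or a verbatim quotation of a PUBLISHED theorem with page reference. The manuscript(s) under audit are NOT citable for their own
disputed steps — they are the thing under adjudication; programme-internal (2001/route/tribunal) claims are never citable.»

WHY.  The road's pointwise currency (`Decays K C δ`, `BiLoc`) pays `Zl D (rate gap) ≍ n⁴` at EVERY composition (`BalabanStepJetsSucc.decays_comp`); the
co-frame words have three legs per two gauged weights, so that currency cannot be n-uniform (W-1 (F1)).  Row∕column masses `sup_x Σ_y Σ_{ab}|K x y a b|·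
e^{θ|x−y|₁}` multiply under composition with NO constant; the lattice constant is paid ONCE per word (FILE α2's vertex sandwich) and ONCE when a
pointwise letter is converted (`rowMass_of_fib_le`, for LOCAL stencils and unit-lattice kernels where the rate gap is `O(1)`).

CONTENT (all [folklore] unless marked; `θ ≥ 0` where stated).
* §1 [our objects] `rowFn K θ x y := (Σ_{ab}|K x y a b|)·e^{θ|x−y|₁}`; `RowMass K θ M` (every row profile summable, sums `≤ M`), `ColMass K θ M` (columns),
  `TotMass K M` (`Σ'_{(x,y)} Σ_{ab}|K x y a b| ≤ M` on `Site × Site`); `rowFn_trK`, `colMass_iff_rowMass_trK`, `RowMass.nonneg ∕ rowFn_le ∕ abs_le`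
  (sup `≤ M` for `θ ≥ 0`), `RowMass.mono` (weight down, bound up), column twins.
* §2 `RowMass.add ∕ smul ∕ neg ∕ sub` and column twins (`|c|·M`, `M + M′`).
* §3 `fib_prod_le`, `abs_comp_le` ∕ `rowFn_zero_comp_le` ∕ `rowFn_comp_le` (`rowFn (A∘B) θ x z ≤ Σ'_y rowFn A θ x y·rowFn B θ y z` whenever the right
  side is summable — triangle inequality), **`rowMass_comp`**: `RowMass A θ M_A → RowMass B θ M_B → RowMass (A∘B) θ (M_A·M_B)`, **`colMass_comp`**.
* §4 `rowMass_of_fib_le` ∕ `colMass_of_fib_le` (`Σ_{ab}|K x y a b| ≤ C·e^{−δ|x−y|₁}`, `θ < δ` ⟹ mass `C·Zl D (δ−θ)`), `rowMass_of_decays`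
  (`Decays K C δ` ⟹ both masses `(card F)²·C·Zl D (δ−θ)`).
NOT HERE: total-mass composition and the vertex sandwich (α2 `KernelMassTotal`), the leg masses (γ), the co-frame words (δ).
Unit `b2b-balaban-gan24-formalise-leaf-05` (gen 54), G-an2-4 swarm leaf prover 05, road «BF-x» (C1)(C2) count owner; INTENT «MASS-CALC» (journal).
-/


noncomputable section

namespace Summit.QuantumFields.BalabanUV.Beta.D1BFx.KernelMassCalculus

open scoped BigOperators
open Finset
open Literature.MathematicalPhysics.QuantumFieldTheory.Balaban1983to89
open Literature.MathematicalPhysics.QuantumFieldTheory.Balaban1983to89.Beta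
open B12Sec2to5 (l1 l1_nonneg)
open ExpKernelCalculus (Site MKer comp Decays Zl Zl_pos l1_sub_triangle l1_sub_symm summable_exp_shift tsum_exp_shift)
open Summit.QuantumFields.BalabanUV.Beta.TameKernelCalculus (trK trK_comp trK_trK)

variable {D : ℕ} {F : Type*} [Fintype F]

/-! ## §1 The currency -/

/-- [our object] **THE θ-WEIGHTED ROW PROFILE** of a kernel: `rowFn K θ x y := (Σ_{a b} |K x y a b|)·e^{θ|x−y|₁}`. A definition; asserts nothing. -/
def rowFn (K : MKer D F) (θ : ℝ) (x y : Site D) : ℝ := (∑ a, ∑ b, |K x y a b|) * Real.exp (θ * l1 (x - y))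

/-- [our object] **θ-WEIGHTED ROW MASS ≤ M**: every row profile is summable with sum `≤ M` (`sup_x Σ_y Σ_{ab}|K x y a b|e^{θ|x−y|₁} ≤ M`).
A bookkeeping predicate; asserts nothing by itself. -/
def RowMass (K : MKer D F) (θ M : ℝ) : Prop := ∀ x, Summable (rowFn K θ x) ∧ ∑' y, rowFn K θ x y ≤ M

/-- [our object] **θ-WEIGHTED COLUMN MASS ≤ M**: `sup_y Σ_x Σ_{ab}|K x y a b|e^{θ|x−y|₁} ≤ M`. A bookkeeping predicate. -/
def ColMass (K : MKer D F) (θ M : ℝ) : Prop := ∀ y, Summable (fun x => rowFn K θ x y) ∧ ∑' x, rowFn K θ x y ≤ M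

/-- [our object] **TOTAL MASS ≤ M** (both site indices summed, no weight): `Σ_{(x,y)} Σ_{ab} |K x y a b| ≤ M`, summable on `Site × Site`.
A bookkeeping predicate (the shape of the road's table letters `Σ'_{(p,q)} Σ_{g f} |blk … p q g f| ≤ mW`). -/
def TotMass (K : MKer D F) (M : ℝ) : Prop :=
  (Summable fun p : Site D × Site D => ∑ a, ∑ b, |K p.1 p.2 a b|) ∧ ∑' p : Site D × Site D, ∑ a, ∑ b, |K p.1 p.2 a b| ≤ M

variable {K L A B : MKer D F} {θ θ' M M' MA MB : ℝ}

omit [Fintype F] in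
/-- [folklore] `rowFn ≥ 0`. -/
theorem rowFn_nonneg [Fintype F] (K : MKer D F) (θ : ℝ) (x y : Site D) : 0 ≤ rowFn K θ x y :=
  mul_nonneg (Finset.sum_nonneg fun _ _ => Finset.sum_nonneg fun _ _ => abs_nonneg _) (Real.exp_pos _).le

/-- [folklore] The transpose swaps the two profiles: `rowFn (trK K) θ x y = rowFn K θ y x`. -/
theorem rowFn_trK (K : MKer D F) (θ : ℝ) (x y : Site D) : rowFn (trK K) θ x y = rowFn K θ y x := by
  unfold rowFn trK
  rw [l1_sub_symm, Finset.sum_comm]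

/-- [folklore] The row profile of the transpose, as a function. -/
theorem rowFn_trK_fun (K : MKer D F) (θ : ℝ) (x : Site D) : rowFn (trK K) θ x = fun y => rowFn K θ y x :=
  funext fun y => rowFn_trK K θ x y

/-- [folklore] `ColMass K θ M ↔ RowMass (trK K) θ M`. -/
theorem colMass_iff_rowMass_trK : ColMass K θ M ↔ RowMass (trK K) θ M := by
  unfold ColMass RowMass
  simp_rw [rowFn_trK_fun]

/-- [folklore] `RowMass K θ M ↔ ColMass (trK K) θ M`. -/
theorem rowMass_iff_colMass_trK : RowMass K θ M ↔ ColMass (trK K) θ M := by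
  rw [colMass_iff_rowMass_trK, trK_trK]

/-- [folklore] The bound is nonnegative. -/
theorem RowMass.nonneg (h : RowMass K θ M) : 0 ≤ M :=
  (tsum_nonneg fun y => rowFn_nonneg K θ 0 y).trans (h 0).2

/-- [folklore] The bound is nonnegative. -/
theorem ColMass.nonneg (h : ColMass K θ M) : 0 ≤ M :=
  (tsum_nonneg fun x => rowFn_nonneg K θ x 0).trans (h 0).2

/-- [folklore] One term is below the row sum: `Σ_{ab}|K x y a b|·e^{θ|x−y|₁} ≤ M`. -/
theorem RowMass.rowFn_le (h : RowMass K θ M) (x y : Site D) : rowFn K θ x y ≤ M :=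
  ((h x).1.le_tsum y fun z _ => rowFn_nonneg K θ x z).trans (h x).2

/-- [folklore] **SUP BOUND from a row mass** (`θ ≥ 0`): `|K x y a b| ≤ M`. -/
theorem RowMass.abs_le (h : RowMass K θ M) (hθ : 0 ≤ θ) (x y : Site D) (a b : F) : |K x y a b| ≤ M := by
  have h1 := h.rowFn_le x y
  have h2 : |K x y a b| ≤ ∑ a', ∑ b', |K x y a' b'| :=
    (Finset.single_le_sum (f := fun b' => |K x y a b'|) (fun _ _ => abs_nonneg _) (Finset.mem_univ b)).trans
      (Finset.single_le_sum (f := fun a' => ∑ b', |K x y a' b'|) (fun _ _ => Finset.sum_nonneg fun _ _ => abs_nonneg _)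
        (Finset.mem_univ a))
  have h3 : (1 : ℝ) ≤ Real.exp (θ * l1 (x - y)) := Real.one_le_exp (mul_nonneg hθ (l1_nonneg _))
  have h4 : ∑ a', ∑ b', |K x y a' b'| ≤ rowFn K θ x y := by
    unfold rowFn
    exact le_mul_of_one_le_right (Finset.sum_nonneg fun _ _ => Finset.sum_nonneg fun _ _ => abs_nonneg _) h3
  linarith

/-- [folklore] The same from a column mass. -/
theorem ColMass.abs_le (h : ColMass K θ M) (hθ : 0 ≤ θ) (x y : Site D) (a b : F) : |K x y a b| ≤ M := by
  have h' := (colMass_iff_rowMass_trK.1 h).abs_le hθ y x b a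
  simpa [trK] using h'

/-- [folklore] **MONOTONICITY**: a smaller weight and a larger bound. -/
theorem RowMass.mono (h : RowMass K θ M) (hθ : θ' ≤ θ) (hM : M ≤ M') : RowMass K θ' M' := by
  intro x
  have hle : ∀ y, rowFn K θ' x y ≤ rowFn K θ x y := fun y =>
    mul_le_mul_of_nonneg_left (Real.exp_le_exp.2 (mul_le_mul_of_nonneg_right hθ (l1_nonneg _)))
      (Finset.sum_nonneg fun _ _ => Finset.sum_nonneg fun _ _ => abs_nonneg _)
  have hs : Summable (rowFn K θ' x) := (h x).1.of_nonneg_of_le (fun y => rowFn_nonneg K θ' x y) hle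
  exact ⟨hs, (hs.tsum_le_tsum hle (h x).1).trans ((h x).2.trans hM)⟩

/-- [folklore] Monotonicity for columns. -/
theorem ColMass.mono (h : ColMass K θ M) (hθ : θ' ≤ θ) (hM : M ≤ M') : ColMass K θ' M' :=
  colMass_iff_rowMass_trK.2 ((colMass_iff_rowMass_trK.1 h).mono hθ hM)

/-! ## §2 Linear bookkeeping -/

omit [Fintype F] in
/-- [folklore] fibre sums of `|K + L|` split. -/
theorem sum_abs_add_le [Fintype F] (K L : MKer D F) (x y : Site D) :
    ∑ a, ∑ b, |(K + L) x y a b| ≤ (∑ a, ∑ b, |K x y a b|) + ∑ a, ∑ b, |L x y a b| := by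
  rw [← Finset.sum_add_distrib]
  refine Finset.sum_le_sum fun a _ => ?_
  rw [← Finset.sum_add_distrib]
  exact Finset.sum_le_sum fun b _ => abs_add_le _ _

/-- [folklore] **SUM**: `RowMass K θ M → RowMass L θ M′ → RowMass (K + L) θ (M + M′)`. -/
theorem RowMass.add (hK : RowMass K θ M) (hL : RowMass L θ M') : RowMass (K + L) θ (M + M') := by
  intro x
  have hle : ∀ y, rowFn (K + L) θ x y ≤ rowFn K θ x y + rowFn L θ x y := fun y => by
    unfold rowFn
    rw [← add_mul]
    exact mul_le_mul_of_nonneg_right (sum_abs_add_le K L x y) (Real.exp_pos _).le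
  have hs : Summable (rowFn (K + L) θ x) :=
    ((hK x).1.add (hL x).1).of_nonneg_of_le (fun y => rowFn_nonneg _ θ x y) hle
  refine ⟨hs, (hs.tsum_le_tsum hle ((hK x).1.add (hL x).1)).trans ?_⟩
  rw [(hK x).1.tsum_add (hL x).1]
  exact add_le_add (hK x).2 (hL x).2

/-- [folklore] Sum, columns. -/
theorem ColMass.add (hK : ColMass K θ M) (hL : ColMass L θ M') : ColMass (K + L) θ (M + M') :=
  colMass_iff_rowMass_trK.2 (by
    rw [TameKernelCalculus.trK_add]
    exact (colMass_iff_rowMass_trK.1 hK).add (colMass_iff_rowMass_trK.1 hL))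

/-- [folklore] **SCALAR MULTIPLE**: `RowMass K θ M → RowMass (c • K) θ (|c|·M)`. -/
theorem RowMass.smul (hK : RowMass K θ M) (c : ℝ) : RowMass (c • K) θ (|c| * M) := by
  intro x
  have heq : ∀ y, rowFn (c • K) θ x y = |c| * rowFn K θ x y := fun y => by
    unfold rowFn
    simp only [Pi.smul_apply, smul_eq_mul, abs_mul]
    have : ∑ a, ∑ b, |c| * |K x y a b| = |c| * ∑ a, ∑ b, |K x y a b| := by simp_rw [Finset.mul_sum]
    rw [this]
    ring
  have hfun : rowFn (c • K) θ x = fun y => |c| * rowFn K θ x y := funext heq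
  rw [hfun]
  refine ⟨(hK x).1.mul_left _, ?_⟩
  rw [tsum_mul_left]
  exact mul_le_mul_of_nonneg_left (hK x).2 (abs_nonneg c)

/-- [folklore] Scalar multiple, columns. -/
theorem ColMass.smul (hK : ColMass K θ M) (c : ℝ) : ColMass (c • K) θ (|c| * M) :=
  colMass_iff_rowMass_trK.2 (by
    have h := (colMass_iff_rowMass_trK.1 hK).smul c
    exact h)

/-- [folklore] **NEGATION** keeps the mass. -/
theorem RowMass.neg (hK : RowMass K θ M) : RowMass (-K) θ M := by
  intro x
  have heq : rowFn (-K) θ x = rowFn K θ x := by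
    funext y; unfold rowFn; simp only [Pi.neg_apply, abs_neg]
  rw [heq]; exact hK x

/-- [folklore] Negation, columns. -/
theorem ColMass.neg (hK : ColMass K θ M) : ColMass (-K) θ M :=
  colMass_iff_rowMass_trK.2 (by rw [TameKernelCalculus.trK_neg]; exact (colMass_iff_rowMass_trK.1 hK).neg)

/-- [folklore] **DIFFERENCE**: `RowMass (K − L) θ (M + M′)`. -/
theorem RowMass.sub (hK : RowMass K θ M) (hL : RowMass L θ M') : RowMass (K - L) θ (M + M') := by
  rw [sub_eq_add_neg]; exact hK.add hL.neg

/-- [folklore] Difference, columns. -/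
theorem ColMass.sub (hK : ColMass K θ M) (hL : ColMass L θ M') : ColMass (K - L) θ (M + M') := by
  rw [sub_eq_add_neg]; exact hK.add hL.neg

/-! ## §3 Composition: masses multiply -/

omit [Fintype F] in
/-- [folklore] fibre bookkeeping: `Σ_{a b f} |A a f|·|B f b| ≤ (Σ_{a f}|A a f|)·(Σ_{f b}|B f b|)` (add the nonnegative off-diagonal terms). -/
theorem fib_prod_le [Fintype F] (P Q : F → F → ℝ) (hP : ∀ a f, 0 ≤ P a f) (hQ : ∀ f b, 0 ≤ Q f b) :
    ∑ a, ∑ b, ∑ f, P a f * Q f b ≤ (∑ a, ∑ f, P a f) * ∑ f, ∑ b, Q f b := by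
  have h1 : ∀ a f, ∑ b, P a f * Q f b ≤ P a f * ∑ f', ∑ b, Q f' b := fun a f => by
    rw [← Finset.mul_sum]
    exact mul_le_mul_of_nonneg_left (Finset.single_le_sum (f := fun f' => ∑ b, Q f' b)
      (fun _ _ => Finset.sum_nonneg fun b _ => hQ _ _) (Finset.mem_univ f)) (hP a f)
  calc ∑ a, ∑ b, ∑ f, P a f * Q f b = ∑ a, ∑ f, ∑ b, P a f * Q f b := by
        refine Finset.sum_congr rfl fun a _ => Finset.sum_comm
    _ ≤ ∑ a, ∑ f, P a f * ∑ f', ∑ b, Q f' b := Finset.sum_le_sum fun a _ => Finset.sum_le_sum fun f _ => h1 a f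
    _ = (∑ a, ∑ f, P a f) * ∑ f, ∑ b, Q f b := by rw [Finset.sum_mul]; refine Finset.sum_congr rfl fun a _ => by rw [Finset.sum_mul]

/-- [folklore] The plain fibre mass is the `θ = 0` row profile: `rowFn K 0 x y = Σ_{ab}|K x y a b|`. -/
theorem rowFn_zero (K : MKer D F) (x y : Site D) : rowFn K 0 x y = ∑ a, ∑ b, |K x y a b| := by
  unfold rowFn; rw [zero_mul, Real.exp_zero, mul_one]

/-- [folklore] The `θ`-profile dominates the plain one (`θ ≥ 0`). -/
theorem rowFn_zero_le (K : MKer D F) (hθ : 0 ≤ θ) (x y : Site D) : rowFn K 0 x y ≤ rowFn K θ x y := by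
  rw [rowFn_zero]
  exact le_mul_of_one_le_right (Finset.sum_nonneg fun _ _ => Finset.sum_nonneg fun _ _ => abs_nonneg _)
    (Real.one_le_exp (mul_nonneg hθ (l1_nonneg _)))

/-- [folklore] One fibre entry is below the fibre mass. -/
theorem abs_le_rowFn_zero (K : MKer D F) (x y : Site D) (a b : F) : |K x y a b| ≤ rowFn K 0 x y := by
  rw [rowFn_zero]
  exact (Finset.single_le_sum (f := fun b' => |K x y a b'|) (fun _ _ => abs_nonneg _) (Finset.mem_univ b)).trans
    (Finset.single_le_sum (f := fun a' => ∑ b', |K x y a' b'|) (fun _ _ => Finset.sum_nonneg fun _ _ => abs_nonneg _)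
      (Finset.mem_univ a))

/-- [folklore] The absolutely convergent majorant of one entry of `comp A B`: if `y ↦ rowFn A 0 x y · rowFn B 0 y z` is summable then so is
`y ↦ Σ_f |A x y a f|·|B y z f b|`, termwise below it. -/
theorem summable_compTerm_abs {x z : Site D} (hs : Summable fun y => rowFn A 0 x y * rowFn B 0 y z) (a b : F) :
    Summable (fun y => ∑ f, |A x y a f| * |B y z f b|) ∧ ∀ y, ∑ f, |A x y a f| * |B y z f b| ≤ rowFn A 0 x y * rowFn B 0 y z := by
  have hle : ∀ y, ∑ f, |A x y a f| * |B y z f b| ≤ rowFn A 0 x y * rowFn B 0 y z := fun y =>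
    calc ∑ f, |A x y a f| * |B y z f b| ≤ ∑ f, |A x y a f| * rowFn B 0 y z :=
          Finset.sum_le_sum fun f _ => mul_le_mul_of_nonneg_left (abs_le_rowFn_zero B y z f b) (abs_nonneg _)
      _ = (∑ f, |A x y a f|) * rowFn B 0 y z := by rw [Finset.sum_mul]
      _ ≤ rowFn A 0 x y * rowFn B 0 y z := by
          refine mul_le_mul_of_nonneg_right ?_ (rowFn_nonneg _ _ _ _)
          rw [rowFn_zero]
          exact Finset.single_le_sum (f := fun a' => ∑ f, |A x y a' f|) (fun _ _ => Finset.sum_nonneg fun _ _ => abs_nonneg _)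
            (Finset.mem_univ a)
  exact ⟨hs.of_nonneg_of_le (fun y => Finset.sum_nonneg fun _ _ => mul_nonneg (abs_nonneg _) (abs_nonneg _)) hle, hle⟩

/-- [folklore] **ENTRY BOUND**: `|comp A B x z a b| ≤ Σ'_y Σ_f |A x y a f|·|B y z f b|` when the fibre-mass product series is summable. -/
theorem abs_comp_le {x z : Site D} (hs : Summable fun y => rowFn A 0 x y * rowFn B 0 y z) (a b : F) :
    |comp A B x z a b| ≤ ∑' y, ∑ f, |A x y a f| * |B y z f b| := by
  unfold ExpKernelCalculus.comp
  have hsum := (summable_compTerm_abs hs a b).1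
  have hn : Summable fun y => ‖∑ f, A x y a f * B y z f b‖ :=
    hsum.of_nonneg_of_le (fun _ => norm_nonneg _) fun y => by
      rw [Real.norm_eq_abs]
      refine (Finset.abs_sum_le_sum_abs _ _).trans (le_of_eq ?_)
      exact Finset.sum_congr rfl fun f _ => abs_mul _ _
  refine (norm_tsum_le_tsum_norm hn).trans (hn.tsum_le_tsum (fun y => ?_) hsum)
  rw [Real.norm_eq_abs]
  refine (Finset.abs_sum_le_sum_abs _ _).trans (le_of_eq ?_)
  exact Finset.sum_congr rfl fun f _ => abs_mul _ _

/-- [folklore] **THE FIBRE MASS OF A COMPOSITION**: `rowFn (A∘B) 0 x z ≤ Σ'_y rowFn A 0 x y · rowFn B 0 y z` when the right side is summable. -/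
theorem rowFn_zero_comp_le {x z : Site D} (hs : Summable fun y => rowFn A 0 x y * rowFn B 0 y z) :
    rowFn (comp A B) 0 x z ≤ ∑' y, rowFn A 0 x y * rowFn B 0 y z := by
  have hg : ∀ a b, Summable (fun y => ∑ f, |A x y a f| * |B y z f b|) := fun a b => (summable_compTerm_abs hs a b).1
  have h1 : ∑ a, ∑ b, |comp A B x z a b| ≤ ∑ a, ∑ b, ∑' y, ∑ f, |A x y a f| * |B y z f b| :=
    Finset.sum_le_sum fun a _ => Finset.sum_le_sum fun b _ => abs_comp_le hs a b
  have h2 : ∑ a, ∑ b, ∑' y, ∑ f, |A x y a f| * |B y z f b| = ∑' y, ∑ a, ∑ b, ∑ f, |A x y a f| * |B y z f b| := by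
    have hin : ∀ a, ∑ b, ∑' y, ∑ f, |A x y a f| * |B y z f b| = ∑' y, ∑ b, ∑ f, |A x y a f| * |B y z f b| := fun a =>
      (Summable.tsum_finsetSum (fun b _ => hg a b)).symm
    simp_rw [hin]
    exact (Summable.tsum_finsetSum (fun a _ => summable_sum fun b _ => hg a b)).symm
  have h3 : ∀ y, ∑ a, ∑ b, ∑ f, |A x y a f| * |B y z f b| ≤ rowFn A 0 x y * rowFn B 0 y z := fun y => by
    rw [rowFn_zero, rowFn_zero]
    exact fib_prod_le (fun a f => |A x y a f|) (fun f b => |B y z f b|) (fun _ _ => abs_nonneg _) (fun _ _ => abs_nonneg _)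
  have hs3 : Summable fun y => ∑ a, ∑ b, ∑ f, |A x y a f| * |B y z f b| :=
    summable_sum fun a _ => summable_sum fun b _ => hg a b
  rw [h2] at h1
  rw [rowFn_zero]
  exact h1.trans (hs3.tsum_le_tsum h3 hs)

/-- [folklore] **THE θ-PROFILE OF A COMPOSITION**: `rowFn (A∘B) θ x z ≤ Σ'_y rowFn A θ x y · rowFn B θ y z` (`θ ≥ 0`; triangle inequality
`|x−z|₁ ≤ |x−y|₁ + |y−z|₁`) when the right side is summable. -/
theorem rowFn_comp_le {x z : Site D} (hθ : 0 ≤ θ) (hs : Summable fun y => rowFn A θ x y * rowFn B θ y z) :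
    rowFn (comp A B) θ x z ≤ ∑' y, rowFn A θ x y * rowFn B θ y z := by
  have hs0 : Summable fun y => rowFn A 0 x y * rowFn B 0 y z :=
    hs.of_nonneg_of_le (fun y => mul_nonneg (rowFn_nonneg _ _ _ _) (rowFn_nonneg _ _ _ _))
      (fun y => mul_le_mul (rowFn_zero_le A hθ x y) (rowFn_zero_le B hθ y z) (rowFn_nonneg _ _ _ _) (rowFn_nonneg _ _ _ _))
  have hle := rowFn_zero_comp_le hs0
  have hexp : ∀ y, Real.exp (θ * l1 (x - z)) ≤ Real.exp (θ * l1 (x - y)) * Real.exp (θ * l1 (y - z)) := fun y => by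
    rw [← Real.exp_add, Real.exp_le_exp, ← mul_add]
    exact mul_le_mul_of_nonneg_left (l1_sub_triangle x y z) hθ
  have hkey : ∀ y, rowFn A 0 x y * rowFn B 0 y z * Real.exp (θ * l1 (x - z)) ≤ rowFn A θ x y * rowFn B θ y z := fun y => by
    calc rowFn A 0 x y * rowFn B 0 y z * Real.exp (θ * l1 (x - z))
        ≤ rowFn A 0 x y * rowFn B 0 y z * (Real.exp (θ * l1 (x - y)) * Real.exp (θ * l1 (y - z))) :=
          mul_le_mul_of_nonneg_left (hexp y) (mul_nonneg (rowFn_nonneg _ _ _ _) (rowFn_nonneg _ _ _ _))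
      _ = rowFn A θ x y * rowFn B θ y z := by rw [rowFn_zero, rowFn_zero]; unfold rowFn; ring
  have e0 : rowFn (comp A B) θ x z = rowFn (comp A B) 0 x z * Real.exp (θ * l1 (x - z)) := by rw [rowFn_zero]; rfl
  rw [e0]
  calc rowFn (comp A B) 0 x z * Real.exp (θ * l1 (x - z)) ≤ (∑' y, rowFn A 0 x y * rowFn B 0 y z) * Real.exp (θ * l1 (x - z)) :=
        mul_le_mul_of_nonneg_right hle (Real.exp_pos _).le
    _ = ∑' y, rowFn A 0 x y * rowFn B 0 y z * Real.exp (θ * l1 (x - z)) := by rw [tsum_mul_right]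
    _ ≤ _ := (hs0.mul_right _).tsum_le_tsum hkey hs

/-- [folklore] **ROW MASSES MULTIPLY**: `RowMass A θ M_A → RowMass B θ M_B → RowMass (A∘B) θ (M_A·M_B)` for `θ ≥ 0` — the point of the currency
(no lattice constant `Zl` per composition). -/
theorem rowMass_comp (hA : RowMass A θ MA) (hB : RowMass B θ MB) (hθ : 0 ≤ θ) : RowMass (comp A B) θ (MA * MB) := by
  intro x
  have hprod : ∀ z, Summable fun y => rowFn A θ x y * rowFn B θ y z := fun z =>
    ((hA x).1.mul_right MB).of_nonneg_of_le (fun y => mul_nonneg (rowFn_nonneg _ _ _ _) (rowFn_nonneg _ _ _ _))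
      (fun y => mul_le_mul_of_nonneg_left (hB.rowFn_le y z) (rowFn_nonneg _ _ _ _))
  have hfin : ∀ S : Finset (Site D), ∑ z ∈ S, rowFn (comp A B) θ x z ≤ MA * MB := by
    intro S
    have h1 : ∑ z ∈ S, rowFn (comp A B) θ x z ≤ ∑ z ∈ S, ∑' y, rowFn A θ x y * rowFn B θ y z :=
      Finset.sum_le_sum fun z _ => rowFn_comp_le hθ (hprod z)
    have h2 : ∑ z ∈ S, ∑' y, rowFn A θ x y * rowFn B θ y z = ∑' y, rowFn A θ x y * ∑ z ∈ S, rowFn B θ y z := by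
      rw [← Summable.tsum_finsetSum (fun z _ => hprod z)]
      exact tsum_congr fun y => by rw [Finset.mul_sum]
    have h3 : ∀ y, rowFn A θ x y * ∑ z ∈ S, rowFn B θ y z ≤ rowFn A θ x y * MB := fun y =>
      mul_le_mul_of_nonneg_left (((hB y).1.sum_le_tsum S fun z _ => rowFn_nonneg _ _ _ _).trans (hB y).2) (rowFn_nonneg _ _ _ _)
    have hs3 : Summable fun y => rowFn A θ x y * ∑ z ∈ S, rowFn B θ y z := by
      have : (fun y => rowFn A θ x y * ∑ z ∈ S, rowFn B θ y z) = fun y => ∑ z ∈ S, rowFn A θ x y * rowFn B θ y z := by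
        funext y; rw [Finset.mul_sum]
      rw [this]
      exact summable_sum fun z _ => hprod z
    rw [h2] at h1
    refine h1.trans ((hs3.tsum_le_tsum h3 ((hA x).1.mul_right MB)).trans ?_)
    rw [tsum_mul_right]
    exact mul_le_mul_of_nonneg_right (hA x).2 hB.nonneg
  exact ⟨summable_of_sum_le (fun z => rowFn_nonneg _ _ _ _) hfin, Real.tsum_le_of_sum_le (fun z => rowFn_nonneg _ _ _ _) hfin⟩

/-- [folklore] **COLUMN MASSES MULTIPLY**: `ColMass A θ M_A → ColMass B θ M_B → ColMass (A∘B) θ (M_A·M_B)` (`θ ≥ 0`; via `trK (A∘B) = trK B ∘ trK A`). -/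
theorem colMass_comp (hA : ColMass A θ MA) (hB : ColMass B θ MB) (hθ : 0 ≤ θ) : ColMass (comp A B) θ (MA * MB) := by
  rw [colMass_iff_rowMass_trK, trK_comp, mul_comm]
  exact rowMass_comp (colMass_iff_rowMass_trK.1 hB) (colMass_iff_rowMass_trK.1 hA) hθ

/-! ## §4 From the road's pointwise letters to masses -/

/-- [folklore] **FROM A FIBRE ENVELOPE TO A ROW MASS**: `Σ_{ab}|K x y a b| ≤ C·e^{−δ|x−y|₁}` for all `x y` and `θ < δ` ⟹ `RowMass K θ (C·Zl D (δ−θ))`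
(the ONE place a lattice constant is paid — for LOCAL stencils and unit-lattice kernels `δ − θ = O(1)`). -/
theorem rowMass_of_fib_le {C δ : ℝ} (hK : ∀ x y, ∑ a, ∑ b, |K x y a b| ≤ C * Real.exp (-δ * l1 (x - y))) (hθ : θ < δ) :
    RowMass K θ (C * Zl D (δ - θ)) := by
  have hC : 0 ≤ C := by
    have h := hK 0 0
    rw [sub_self] at h
    have h0 : l1 (0 : Site D) = 0 := by simp [l1]
    rw [h0, mul_zero, Real.exp_zero, mul_one] at h
    exact (Finset.sum_nonneg fun _ _ => Finset.sum_nonneg fun _ _ => abs_nonneg _).trans h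
  intro x
  have hle : ∀ y, rowFn K θ x y ≤ C * Real.exp (-(δ - θ) * l1 (x - y)) := fun y => by
    unfold rowFn
    calc (∑ a, ∑ b, |K x y a b|) * Real.exp (θ * l1 (x - y)) ≤ C * Real.exp (-δ * l1 (x - y)) * Real.exp (θ * l1 (x - y)) :=
          mul_le_mul_of_nonneg_right (hK x y) (Real.exp_pos _).le
      _ = C * Real.exp (-(δ - θ) * l1 (x - y)) := by rw [mul_assoc, ← Real.exp_add]; ring_nf
  have hs : Summable fun y => C * Real.exp (-(δ - θ) * l1 (x - y)) := (summable_exp_shift (by linarith) x).mul_left C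
  have hsK : Summable (rowFn K θ x) := hs.of_nonneg_of_le (fun y => rowFn_nonneg _ _ _ _) hle
  refine ⟨hsK, (hsK.tsum_le_tsum hle hs).trans (le_of_eq ?_)⟩
  rw [tsum_mul_left, tsum_exp_shift]

/-- [folklore] The same for columns (`|y−x|₁ = |x−y|₁`). -/
theorem colMass_of_fib_le {C δ : ℝ} (hK : ∀ x y, ∑ a, ∑ b, |K x y a b| ≤ C * Real.exp (-δ * l1 (x - y))) (hθ : θ < δ) :
    ColMass K θ (C * Zl D (δ - θ)) := by
  rw [colMass_iff_rowMass_trK]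
  refine rowMass_of_fib_le (fun x y => ?_) hθ
  have h := hK y x
  rw [l1_sub_symm] at h
  calc ∑ a, ∑ b, |trK K x y a b| = ∑ b, ∑ a, |K y x b a| := Finset.sum_comm
    _ ≤ _ := h

/-- [folklore] **FROM `Decays` TO MASSES**: `Decays K C δ`, `θ < δ` ⟹ `RowMass K θ ((card F)²·C·Zl D (δ−θ))` and the same `ColMass`. -/
theorem rowMass_of_decays {C δ : ℝ} (hK : Decays K C δ) (hθ : θ < δ) :
    RowMass K θ ((Fintype.card F : ℝ) ^ 2 * C * Zl D (δ - θ)) ∧ ColMass K θ ((Fintype.card F : ℝ) ^ 2 * C * Zl D (δ - θ)) := by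
  have hfib : ∀ x y, ∑ a, ∑ b, |K x y a b| ≤ ((Fintype.card F : ℝ) ^ 2 * C) * Real.exp (-δ * l1 (x - y)) := fun x y => by
    calc ∑ a, ∑ b, |K x y a b| ≤ ∑ _a : F, ∑ _b : F, C * Real.exp (-δ * l1 (x - y)) :=
          Finset.sum_le_sum fun a _ => Finset.sum_le_sum fun b _ => hK x y a b
      _ = ((Fintype.card F : ℝ) ^ 2 * C) * Real.exp (-δ * l1 (x - y)) := by
          simp only [Finset.sum_const, Finset.card_univ, nsmul_eq_mul]; ring
  exact ⟨rowMass_of_fib_le hfib hθ, colMass_of_fib_le hfib hθ⟩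

end Summit.QuantumFields.BalabanUV.Beta.D1BFx.KernelMassCalculus

end
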